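import Literature.Geometry.ComplexAnalytic.MarkedFamilyHomCriterion      -- ★ `IsRelExpChartOn`, `mdifferentiableOn_uncurry_clm`
import Mathlib.Analysis.Calculus.ContDiff.Operations                     -- `contDiffAt_map_inverse`
import Mathlib.Topology.Algebra.Module.FiniteDimension
import HarnessLib

/-!
# Re-framing a relative exponential chart: a holomorphic fibrewise-linear change of coordinates and an integral change of
# lattice basis give a NEW chart of the SAME family (converse of ★ `IsRelExpChartOn.exists_transition`)
# ([BirkenhakeLange2004] §1.1–§1.2, Ch. 8 §8.7; [LangeBirkenhake1992] §1.1.2 Prop. 1.1.6; [Shimura1963AnalyticFamilies] §2)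

Layer `Literature/Geometry/ComplexAnalytic`, namespace `Literature.Geometry.ComplexAnalytic.IsRelExpChartOn`.  THEOREMS ONLY (no
definition, no named fact, no instance, no notation, no `sorry`).  Cell `hodgecm-mathlib` (D-0151), FLOOR 0, P6 «MOD» (crux hLiu418 =
stmt-HodgeConjecture-24832, `--supports`), half A line L7 (socket `stub_UNIVFAM`, printed letter P-3 «UNIV-FAMILY» ★
`siegelUniversalFamilyUniformisation`): the SYNTHESIS step «ALIGN» of the L7 road — once the integral change of frame between an
arbitrary local chart of `(P_T.A)^an` (★ P-1) and the tautological frame `Π_{s t}` is known to be ONE matrix `T ∈ GL(ℤ)` and the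
`ℂ`-linear parts `L t` are known to be holomorphic in `t`, THIS file produces the chart with the tautological period family.
HC_CM is proved only modulo the printed citations until rung 0 closes; this file is generic and changes no count.

THE MATHEMATICS ([BirkenhakeLange2004] §1.2: a homomorphism of complex tori is given by a `ℂ`-linear map of the universal covers
carrying lattice to lattice — its analytic and rational representations; in families, [Shimura1963AnalyticFamilies] §2 and
[BirkenhakeLange2004] §8.7: over `𝔥_g` the family `𝔛 → 𝔥_g` is `(ℂ^g × 𝔥_g) ∕ {(Z, 1)ℤ^{2g}}`, any other trivialisation of
`Lie ∕ R₁` differing by a holomorphic `GL_g(ℂ)`-valued function and a constant `GL_{2g}(ℤ)`-matrix).  Let `ex : B × E → M` be a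
relative exponential chart of `p : M → B` over `U` with period family `Φ` (★ `IsRelExpChartOn EB EM p U Φ ex`).  Let
`L : B → (E′ →L[ℂ] E)` be holomorphic on `U` (operator-valued) with every `L b`, `b ∈ U`, bijective, let `T` be an integer matrix with a
right inverse `T′` over `ℤ` (`T T′ = 1`), and let `Φ₂ : B → ((ι′ → ℝ) ≃L[ℝ] E′)` satisfy the FRAME RELATION `Φ b ∘ T_ℝ = L b ∘ Φ₂ b` on `U` — exactly the
output shape of ★ `exists_transition` ∕ `exists_chartComparison`.  THEN `ex₂ (b, z′) := ex (b, L b z′)` is a relative exponential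
chart of the same family over `U` with period family `Φ₂` (`reframe`): its periods `b ↦ Φ₂ b x = (L b)⁻¹ (Φ b (T x))` are
holomorphic because inversion is analytic at invertible operators (`mdifferentiableOn_inverse`), `ex₂` is holomorphic on
`U × E′` (evaluation is bilinear), lies over `p`, is onto the fibres, has kernel `Φ₂ b (ℤ^{ι′}) = (L b)⁻¹ Φ b (T ℤ^{ι′}) =
(L b)⁻¹ Φ b (ℤ^ι)`, and is étale: its local inverses are those of `ex` followed by the biholomorphism `(b, z) ↦ (b, (L b)⁻¹ z)`.

* `mdifferentiableOn_inverse` — `b ↦ (L b)⁻¹` (Mathlib `ContinuousLinearMap.inverse`) is holomorphic on `U` (finite-dimensional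
  fibres); `inverse_apply_of_bijective` ∕ `apply_inverse_of_bijective` — it inverts `L b` on `U`.
* `mdifferentiableOn_period_of_frame` — the re-framed period family is holomorphic on `U`.
* HEAD `reframe` — `IsRelExpChartOn EB EM p U Φ₂ (fun q ↦ ex (q.1, L q.1 q.2))`.
* `reframe_fibre_eq` — the two charts have the same image fibrewise (bookkeeping for (G)∕(ADM) transports).

## References
* [BirkenhakeLange2004] C. Birkenhake, H. Lange, *Complex Abelian Varieties*, 2nd ed. (2004), §1.1 (tori `V ∕ Λ`, `π : V → X`),
  §1.2 Prop. 1.2.1 (analytic and rational representations), Ch. 8 §8.7 (the universal family over `𝔥_g`).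
* [LangeBirkenhake1992] H. Lange, Ch. Birkenhake, *Complex Abelian Varieties* (1992), §1.1.2 Prop. 1.1.6.
* [Shimura1963AnalyticFamilies] G. Shimura, *On analytic families of polarized abelian varieties and automorphic functions*,
  Ann. Math. 78 (1963), §2.
-/

set_option autoImplicit false

noncomputable section

open scoped Manifold Topology Matrix
open Set Function

namespace Literature.Geometry.ComplexAnalytic.IsRelExpChartOn

variable {EB : Type*} [NormedAddCommGroup EB] [NormedSpace ℂ EB] {B : Type*} [TopologicalSpace B] [ChartedSpace EB B]
  {E : Type*} [NormedAddCommGroup E] [NormedSpace ℂ E] {ι : Type*}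
  {E' : Type*} [NormedAddCommGroup E'] [NormedSpace ℂ E'] {ι' : Type*}
  {EM : Type*} [NormedAddCommGroup EM] [NormedSpace ℂ EM] {M : Type*} [TopologicalSpace M] [ChartedSpace EM M]
  {p : M → B} {U : Set B} {Φ : B → ((ι → ℝ) ≃L[ℝ] E)} {ex : B × E → M}

/-! ### §1 Holomorphic families of invertible operators: the inverse family -/

section Inverse

variable [FiniteDimensional ℂ E'] {L : B → (E' →L[ℂ] E)}

/-- A bijective continuous linear map between finite-dimensional spaces is (the coercion of) a continuous linear equivalence.
[folklore] -/
private theorem exists_continuousLinearEquiv_coe_eq {f : E' →L[ℂ] E} (hf : Bijective f) :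
    ∃ e : E' ≃L[ℂ] E, (e : E' →L[ℂ] E) = f :=
  ⟨(LinearEquiv.ofBijective (f : E' →ₗ[ℂ] E) hf).toContinuousLinearEquiv, by
    ext x
    rfl⟩

omit [TopologicalSpace B] in
/-- On `U` the operator inverse inverts: `(L b)⁻¹ (L b z′) = z′`. [cite: BirkenhakeLange2004, §1.2 Proposition 1.2.1] -/
theorem inverse_apply_of_bijective (hLb : ∀ b ∈ U, Bijective (L b)) {b : B} (hb : b ∈ U) (z' : E') :
    (L b).inverse (L b z') = z' := by
  obtain ⟨e, he⟩ := exists_continuousLinearEquiv_coe_eq (hLb b hb)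
  rw [← he, ContinuousLinearMap.inverse_equiv]
  exact e.symm_apply_apply z'

omit [TopologicalSpace B] in
/-- On `U` the operator inverse inverts: `L b ((L b)⁻¹ z) = z`. [cite: BirkenhakeLange2004, §1.2 Proposition 1.2.1] -/
theorem apply_inverse_of_bijective (hLb : ∀ b ∈ U, Bijective (L b)) {b : B} (hb : b ∈ U) (z : E) :
    L b ((L b).inverse z) = z := by
  obtain ⟨e, he⟩ := exists_continuousLinearEquiv_coe_eq (hLb b hb)
  rw [← he, ContinuousLinearMap.inverse_equiv]
  exact e.apply_symm_apply z

/-- **The inverse of a holomorphic family of invertible operators is holomorphic** (inversion is analytic on the open set of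
invertible operators — Mathlib `contDiffAt_map_inverse` — composed with `L`). [cite: BirkenhakeLange2004, §1.2] -/
theorem mdifferentiableOn_inverse (hL : MDifferentiableOn 𝓘(ℂ, EB) 𝓘(ℂ, E' →L[ℂ] E) L U)
    (hLb : ∀ b ∈ U, Bijective (L b)) :
    MDifferentiableOn 𝓘(ℂ, EB) 𝓘(ℂ, E →L[ℂ] E') (fun b ↦ (L b).inverse) U := by
  intro b hb
  obtain ⟨e, he⟩ := exists_continuousLinearEquiv_coe_eq (hLb b hb)
  haveI : CompleteSpace E' := FiniteDimensional.complete ℂ E'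
  have hinv : DifferentiableAt ℂ (ContinuousLinearMap.inverse : (E' →L[ℂ] E) → (E →L[ℂ] E')) (L b) := by
    rw [← he]
    exact (contDiffAt_map_inverse (𝕜 := ℂ) (n := 1) e).differentiableAt one_ne_zero
  exact hinv.comp_mdifferentiableWithinAt (hL b hb)

end Inverse

/-! ### §2 The re-framed period family -/

section Frame

variable [Fintype ι'] [FiniteDimensional ℂ E']
  {Φ₂ : B → ((ι' → ℝ) ≃L[ℝ] E')} {L : B → (E' →L[ℂ] E)} {T : Matrix ι ι' ℤ} {T' : Matrix ι' ι ℤ}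

omit [TopologicalSpace B] [FiniteDimensional ℂ E'] in
/-- An integral matrix maps integer vectors to integer vectors (cast form): `T_ℝ n = (T n)` for `n ∈ ℤ^{ι′}`. [folklore] -/
private theorem map_intCast_mulVec_intCast (S : Matrix ι ι' ℤ) (n : ι' → ℤ) :
    (S.map (Int.cast : ℤ → ℝ)) *ᵥ (fun i => (n i : ℝ)) = fun i => ((S *ᵥ n) i : ℝ) := by
  funext i
  have h := RingHom.map_mulVec (Int.castRingHom ℝ) S n i
  simp only [eq_intCast] at h
  rw [h]
  rfl

omit [TopologicalSpace B] in
/-- **The re-framed period family reads through the inverse operators**: on `U`, `Φ₂ b x = (L b)⁻¹ (Φ b (T_ℝ x))`.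
[cite: BirkenhakeLange2004, §1.2 Proposition 1.2.1] -/
theorem period_eq_inverse_apply_of_frame (hLb : ∀ b ∈ U, Bijective (L b))
    (hframe : ∀ b ∈ U, ∀ x, Φ b ((T.map (Int.cast : ℤ → ℝ)) *ᵥ x) = L b (Φ₂ b x)) {b : B} (hb : b ∈ U) (x : ι' → ℝ) :
    Φ₂ b x = (L b).inverse (Φ b ((T.map (Int.cast : ℤ → ℝ)) *ᵥ x)) := by
  rw [hframe b hb x, inverse_apply_of_bijective hLb hb]

/-- **The re-framed period family is holomorphic on `U`** (inverse family holomorphic, `b ↦ Φ b (T x)` holomorphic, evaluation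
bilinear). [cite: BirkenhakeLange2004, §8.7] [cite: Shimura1963AnalyticFamilies, §2] -/
theorem mdifferentiableOn_period_of_frame (h : IsRelExpChartOn EB EM p U Φ ex)
    (hL : MDifferentiableOn 𝓘(ℂ, EB) 𝓘(ℂ, E' →L[ℂ] E) L U) (hLb : ∀ b ∈ U, Bijective (L b))
    (hframe : ∀ b ∈ U, ∀ x, Φ b ((T.map (Int.cast : ℤ → ℝ)) *ᵥ x) = L b (Φ₂ b x)) (x : ι' → ℝ) :
    MDifferentiableOn 𝓘(ℂ, EB) 𝓘(ℂ, E') (fun b ↦ Φ₂ b x) U := by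
  have hcomp : MDifferentiableOn 𝓘(ℂ, EB) 𝓘(ℂ, E')
      (fun b ↦ (L b).inverse (Φ b ((T.map (Int.cast : ℤ → ℝ)) *ᵥ x))) U :=
    (mdifferentiableOn_inverse hL hLb).clm_apply (h.mdifferentiableOn_period _)
  exact hcomp.congr fun b hb ↦ period_eq_inverse_apply_of_frame hLb hframe hb x

end Frame

/-! ### §3 HEAD: the re-framed chart -/

section Head

variable [Fintype ι] [Fintype ι'] [DecidableEq ι] [FiniteDimensional ℂ E']
  {Φ₂ : B → ((ι' → ℝ) ≃L[ℝ] E')} {L : B → (E' →L[ℂ] E)} {T : Matrix ι ι' ℤ} {T' : Matrix ι' ι ℤ}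

/-- **RE-FRAMING A RELATIVE EXPONENTIAL CHART** (converse of ★ `exists_transition`; [BirkenhakeLange2004] §1.2 Prop. 1.2.1 in
families, [Shimura1963AnalyticFamilies] §2): let `ex` be a relative exponential chart of `p : M → B` over `U` with period family
`Φ`, `L : B → (E′ →L[ℂ] E)` holomorphic on `U` with every `L b` (`b ∈ U`) bijective, `T` an integer matrix with a right inverse `T′`
over `ℤ` (`T T′ = 1`), and `Φ₂` a family of real frames with `Φ b ∘ T_ℝ = L b ∘ Φ₂ b` on `U`.  Then `(b, z′) ↦ ex (b, L b z′)` is a relative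
exponential chart of `p` over `U` with period family `Φ₂`.  (L7: `Φ₂ t = Π_{s t}` the tautological frame ★
`SiegelModuli.exists_periodFamily_eq_siegelPeriodMap`, `ex` a ★ P-1 chart of `(P_T.A)^an`, `T` the constant integral change of
frame, `L t eᵢ = δᵢ⁻¹ Φ t (T e_{inr i})`.)
[cite: BirkenhakeLange2004, §1.2 Proposition 1.2.1, §8.7] [cite: LangeBirkenhake1992, §1.1.2 Proposition 1.1.6]
[cite: Shimura1963AnalyticFamilies, §2] -/
theorem reframe (h : IsRelExpChartOn EB EM p U Φ ex)
    (hL : MDifferentiableOn 𝓘(ℂ, EB) 𝓘(ℂ, E' →L[ℂ] E) L U) (hLb : ∀ b ∈ U, Bijective (L b))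
    (hTT' : T * T' = 1)
    (hframe : ∀ b ∈ U, ∀ x, Φ b ((T.map (Int.cast : ℤ → ℝ)) *ᵥ x) = L b (Φ₂ b x)) :
    IsRelExpChartOn EB EM p U Φ₂ (fun q : B × E' ↦ ex (q.1, L q.1 q.2)) := by
  -- the frame change `Ψ (b, z′) = (b, L b z′)` and its inverse `Ψ′ (b, z) = (b, (L b)⁻¹ z)`, holomorphic over `U`
  have hΨ : MDifferentiableOn (𝓘(ℂ, EB).prod 𝓘(ℂ, E')) (𝓘(ℂ, EB).prod 𝓘(ℂ, E))
      (fun q : B × E' ↦ (q.1, L q.1 q.2)) (U ×ˢ univ) := fun q hq ↦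
    mdifferentiableWithinAt_fst.prodMk (mdifferentiableOn_uncurry_clm h.isOpen hL q hq)
  have hΨ' : MDifferentiableOn (𝓘(ℂ, EB).prod 𝓘(ℂ, E)) (𝓘(ℂ, EB).prod 𝓘(ℂ, E'))
      (fun q : B × E ↦ (q.1, (L q.1).inverse q.2)) (U ×ˢ univ) := fun q hq ↦
    mdifferentiableWithinAt_fst.prodMk
      (mdifferentiableOn_uncurry_clm h.isOpen (mdifferentiableOn_inverse hL hLb) q hq)
  have hmaps : MapsTo (fun q : B × E' ↦ (q.1, L q.1 q.2)) (U ×ˢ univ) (U ×ˢ (univ : Set E)) :=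
    fun q hq ↦ ⟨hq.1, mem_univ _⟩
  refine
    { isOpen := h.isOpen
      mdifferentiableOn_period := mdifferentiableOn_period_of_frame h hL hLb hframe
      mdifferentiableOn_ex := h.mdifferentiableOn_ex.comp hΨ hmaps
      p_ex := fun b hb z' ↦ h.p_ex b hb (L b z')
      ex_surj := fun m hm ↦ ?_
      ex_eq_ex_iff := fun b hb z z' ↦ ?_
      exists_localInverse := ?_ }
  · -- onto the fibres
    obtain ⟨z, hz⟩ := h.ex_surj m hm
    refine ⟨(L (p m)).inverse z, ?_⟩
    show ex (p m, L (p m) ((L (p m)).inverse z)) = m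
    rw [apply_inverse_of_bijective hLb hm]
    exact hz
  · -- the kernel is the re-framed lattice
    show ex (b, L b z) = ex (b, L b z') ↔ _
    rw [h.ex_eq_ex_iff b hb (L b z) (L b z')]
    constructor
    · rintro ⟨n, hn⟩
      refine ⟨T' *ᵥ n, (hLb b hb).1 ?_⟩
      rw [map_add, ← hframe b hb, map_intCast_mulVec_intCast]
      simp only [Matrix.mulVec_mulVec, hTT', Matrix.one_mulVec]
      exact hn
    · rintro ⟨n', hn'⟩
      refine ⟨T *ᵥ n', ?_⟩
      rw [hn', map_add, ← hframe b hb, map_intCast_mulVec_intCast]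
  · -- étale: local inverses of `ex` followed by the inverse frame change
    rintro ⟨b₀, z₀'⟩ hx
    obtain ⟨e, hye, hsrc, heq, hd⟩ := h.exists_localInverse (b₀, L b₀ z₀') ⟨hx.1, mem_univ _⟩
    let Ψ : OpenPartialHomeomorph (B × E') (B × E) :=
      { toFun := fun q ↦ (q.1, L q.1 q.2)
        invFun := fun q ↦ (q.1, (L q.1).inverse q.2)
        source := U ×ˢ univ
        target := U ×ˢ univ
        map_source' := fun q hq ↦ ⟨hq.1, mem_univ _⟩
        map_target' := fun q hq ↦ ⟨hq.1, mem_univ _⟩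
        left_inv' := fun q hq ↦ Prod.ext rfl (inverse_apply_of_bijective hLb hq.1 q.2)
        right_inv' := fun q hq ↦ Prod.ext rfl (apply_inverse_of_bijective hLb hq.1 q.2)
        open_source := h.isOpen.prod isOpen_univ
        open_target := h.isOpen.prod isOpen_univ
        continuousOn_toFun := hΨ.continuousOn
        continuousOn_invFun := hΨ'.continuousOn }
    refine ⟨Ψ.trans e, ?_, ?_, ?_, ?_⟩
    · rw [OpenPartialHomeomorph.trans_source]
      exact ⟨⟨hx.1, mem_univ _⟩, hye⟩
    · intro q hq
      rw [OpenPartialHomeomorph.trans_source] at hq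
      exact hq.1
    · intro q hq
      rw [OpenPartialHomeomorph.trans_source] at hq
      rw [OpenPartialHomeomorph.coe_trans, Function.comp_apply, heq _ hq.2]
      rfl
    · rw [OpenPartialHomeomorph.trans_target, OpenPartialHomeomorph.coe_trans_symm]
      exact hΨ'.comp (hd.mono inter_subset_left) fun m hm ↦ hm.2

omit [Fintype ι] [Fintype ι'] [DecidableEq ι] [FiniteDimensional ℂ E'] [TopologicalSpace B] [TopologicalSpace M]
  [ChartedSpace EM M] in
/-- The re-framed chart has the same fibrewise images as the original one: `{ex (b, L b z′)} = {ex (b, z)} = p⁻¹ b` for `b ∈ U`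
(bookkeeping for transporting fibrewise data — (G)∕(ADM) in L7 — between the two charts). [cite: BirkenhakeLange2004, §1.1] -/
theorem range_reframe_fibre_eq (hLb : ∀ b ∈ U, Bijective (L b)) {b : B} (hb : b ∈ U) :
    Set.range (fun z' : E' ↦ ex (b, L b z')) = Set.range (fun z : E ↦ ex (b, z)) := by
  have hcomp : (fun z' : E' ↦ ex (b, L b z')) = (fun z : E ↦ ex (b, z)) ∘ (L b) := rfl
  rw [hcomp, (hLb b hb).2.range_comp]

end Head

end Literature.Geometry.ComplexAnalytic.IsRelExpChartOn

end
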